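import Mathlib
import Summits.Ventures.HodgeRepro2.T5ConductorDictionary

/-!
# T5CharacterDescent — a character of `𝒪^×` of conductor exponent `≤ m + 1` descends to a multiplicative
character of `𝒪 ⧸ (ϖ^{m+1})`; its conductor is exactly `m + 1` iff the descended character is primitive

Kernel support for Tier 5, sub-step N5 / §G [R-4] (route/T5-CHECK-G-p7.md §4, §12.2 row P1.7, §16.2 row P1.10).
`T5ConductorDictionary` goes from a character `χ` of the finite ring `𝒪/𝔭^{m+1}` to the character `pull χ = χ ∘ π`
of `𝒪^×` and reads `IsPrimitiveChar χ` as «`conductor (pull χ) = m + 1`». The application starts at the other end: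
the local component `ω_v` of a Hecke character, restricted to `𝒪_v^×`, is a character `ω' : 𝒪^× → ℂ^×` trivial on
`U_{m+1} = 1 + 𝔭^{m+1}` (conductor exponent `≤ m + 1`), and the Gauss sum is formed with the character of
`(𝒪/𝔭^{m+1})^×` it induces. This file constructs that character and closes the dictionary:

* `unitsMap_surjective` / `ker_unitsMap`: `𝒪^× → (𝒪/𝔭^{m+1})^×` is onto with kernel `U_{m+1}` (so
  `(𝒪/𝔭^{m+1})^× ≅ 𝒪^×/U_{m+1}`);
* `descendUnitHom` / `descendChar`: the induced character of `(𝒪/𝔭^{m+1})^×`, as a `MulChar` (vanishing on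
  the non-units), with `descendChar_mk : descendChar ω' (π u) = ω' u` and `pull_descendChar : pull (descendChar ω') = ω'`;
* **`conductor_eq_iff_isPrimitiveChar_descendChar`**: `conductor (higherUnits ϖ) ω' = m + 1 ↔ IsPrimitiveChar (descendChar ω')`;
* **`gNorm_mul_gNorm_inv_descendChar`**: for `ω'` of conductor exactly `m + 1` and `Ψ` of conductor exactly `𝒪`,
  `𝔤(χ)·𝔤(χ⁻¹) = ω'(−1)` for `χ = descendChar ω'` against `ψ_{m+1} = shiftChar` — the Gauss-sum identity of (T1)
  stated directly for the character of `𝒪^×`.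
-/

namespace Summit.Ventures.HodgeRepro2.T5CharacterDescent

open Summit.Ventures.HodgeRepro2.T5LocalRingGaussSum
open Summit.Ventures.HodgeRepro2.T5DVRQuotientModel
open Summit.Ventures.HodgeRepro2.T5PrincipalUnitFiltration
open Summit.Ventures.HodgeRepro2.T5ConductorArithmetic
open Summit.Ventures.HodgeRepro2.T5ConductorDictionary

variable {𝒪 : Type*} [CommRing 𝒪] [IsDomain 𝒪] [IsDiscreteValuationRing 𝒪] {ϖ : 𝒪} {m : ℕ}
  {R' : Type*} [CommMonoidWithZero R']

/-- The quotient map `𝒪 → 𝒪 ⧸ (ϖ^{m+1})`. -/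
local notation "π" => Ideal.Quotient.mk (Ideal.span ({ϖ ^ (m + 1)} : Set 𝒪))

/-! ### `𝒪^× → (𝒪/𝔭^{m+1})^×` is onto with kernel `U_{m+1}` -/

/-- Every unit of `𝒪 ⧸ (ϖ^{m+1})` is the class of a unit of `𝒪`. -/
theorem unitsMap_surjective (hϖ : Irreducible ϖ) :
    Function.Surjective (Units.map (π : 𝒪 →* 𝒪 ⧸ Ideal.span ({ϖ ^ (m + 1)} : Set 𝒪))) := by
  intro v
  obtain ⟨x, hx⟩ := Ideal.Quotient.mk_surjective (v : 𝒪 ⧸ Ideal.span ({ϖ ^ (m + 1)} : Set 𝒪))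
  have hxu : IsUnit x := by
    rw [isUnit_iff_not_dvd hϖ, ← isUnit_mk_iff hϖ, hx]
    exact v.isUnit
  obtain ⟨u, rfl⟩ := hxu
  exact ⟨u, Units.ext hx⟩

omit [IsDomain 𝒪] [IsDiscreteValuationRing 𝒪] in
/-- The kernel of `𝒪^× → (𝒪/𝔭^{m+1})^×` is `U_{m+1} = 1 + 𝔭^{m+1}`. -/
theorem ker_unitsMap :
    (Units.map (π : 𝒪 →* 𝒪 ⧸ Ideal.span ({ϖ ^ (m + 1)} : Set 𝒪))).ker = higherUnits ϖ (m + 1) := by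
  ext u
  rw [MonoidHom.mem_ker, mem_higherUnits, ← Units.val_eq_one, Units.coe_map, MonoidHom.coe_coe,
    ← map_one (Ideal.Quotient.mk (Ideal.span ({ϖ ^ (m + 1)} : Set 𝒪))), Ideal.Quotient.eq,
    Ideal.mem_span_singleton]

/-! ### The descended character -/

/-- The character of `(𝒪/𝔭^{m+1})^×` induced by a character `ω'` of `𝒪^×` trivial on `U_{m+1}`. -/
noncomputable def descendUnitHom (hϖ : Irreducible ϖ) (ω' : 𝒪ˣ →* R'ˣ)
    (h : higherUnits ϖ (m + 1) ≤ ω'.ker) :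
    (𝒪 ⧸ Ideal.span ({ϖ ^ (m + 1)} : Set 𝒪))ˣ →* R'ˣ :=
  (QuotientGroup.lift (Units.map (π : 𝒪 →* 𝒪 ⧸ Ideal.span ({ϖ ^ (m + 1)} : Set 𝒪))).ker ω'
      (by rw [ker_unitsMap]; exact h)).comp
    (QuotientGroup.quotientKerEquivOfSurjective _ (unitsMap_surjective hϖ)).symm.toMonoidHom

/-- `descendUnitHom ω' (Units.map π u) = ω' u`. -/
@[simp] theorem descendUnitHom_map (hϖ : Irreducible ϖ) (ω' : 𝒪ˣ →* R'ˣ)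
    (h : higherUnits ϖ (m + 1) ≤ ω'.ker) (u : 𝒪ˣ) :
    descendUnitHom hϖ ω' h (Units.map (π : 𝒪 →* 𝒪 ⧸ Ideal.span ({ϖ ^ (m + 1)} : Set 𝒪)) u) = ω' u := by
  unfold descendUnitHom
  rw [MonoidHom.comp_apply, MulEquiv.coe_toMonoidHom]
  have key : (QuotientGroup.quotientKerEquivOfSurjective _ (unitsMap_surjective hϖ)).symm
      (Units.map (π : 𝒪 →* 𝒪 ⧸ Ideal.span ({ϖ ^ (m + 1)} : Set 𝒪)) u)
        = (QuotientGroup.mk u :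
            𝒪ˣ ⧸ (Units.map (π : 𝒪 →* 𝒪 ⧸ Ideal.span ({ϖ ^ (m + 1)} : Set 𝒪))).ker) := by
    rw [MulEquiv.symm_apply_eq]
    unfold QuotientGroup.quotientKerEquivOfSurjective
    rw [QuotientGroup.quotientKerEquivOfRightInverse_apply, QuotientGroup.kerLift_mk]
  rw [key, QuotientGroup.lift_mk]

/-- The induced multiplicative character of `𝒪 ⧸ (ϖ^{m+1})` (vanishing on the non-units). -/
noncomputable def descendChar (hϖ : Irreducible ϖ) (ω' : 𝒪ˣ →* R'ˣ)
    (h : higherUnits ϖ (m + 1) ≤ ω'.ker) : MulChar (𝒪 ⧸ Ideal.span ({ϖ ^ (m + 1)} : Set 𝒪)) R' :=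
  MulChar.ofUnitHom (descendUnitHom hϖ ω' h)

/-- `descendChar ω' (π u) = ω' u` for a unit `u` of `𝒪`. -/
theorem descendChar_mk (hϖ : Irreducible ϖ) (ω' : 𝒪ˣ →* R'ˣ) (h : higherUnits ϖ (m + 1) ≤ ω'.ker)
    (u : 𝒪ˣ) : descendChar hϖ ω' h (π (u : 𝒪)) = ω' u := by
  have : π (u : 𝒪) = ((Units.map (π : 𝒪 →* 𝒪 ⧸ Ideal.span ({ϖ ^ (m + 1)} : Set 𝒪)) u : _ˣ) : _) := rfl
  rw [this, descendChar, MulChar.ofUnitHom_coe, descendUnitHom_map]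

/-- Pulling the descended character back to `𝒪^×` gives back `ω'`. -/
theorem pull_descendChar (hϖ : Irreducible ϖ) (ω' : 𝒪ˣ →* R'ˣ)
    (h : higherUnits ϖ (m + 1) ≤ ω'.ker) : pull (descendChar hϖ ω' h) = ω' := by
  ext u
  rw [pull_apply, descendChar_mk]

/-- **Conductor dictionary, starting from `𝒪^×`.** A character `ω'` of `𝒪^×` trivial on `U_{m+1}` has
conductor exponent exactly `m + 1` iff its descent to `𝒪 ⧸ (ϖ^{m+1})` is primitive. -/
theorem conductor_eq_iff_isPrimitiveChar_descendChar (hϖ : Irreducible ϖ) (ω' : 𝒪ˣ →* R'ˣ)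
    (h : higherUnits ϖ (m + 1) ≤ ω'.ker) :
    conductor (higherUnits ϖ) ω' = m + 1 ↔ IsPrimitiveChar (descendChar hϖ ω' h) := by
  rw [← conductor_pull_eq_iff hϖ, pull_descendChar]

omit [IsDomain 𝒪] [IsDiscreteValuationRing 𝒪] in
/-- A character of conductor exponent exactly `m + 1` is trivial on `U_{m+1}`. -/
theorem higherUnits_le_ker_of_conductor_eq {ω' : 𝒪ˣ →* R'ˣ} (hex : ∃ n, higherUnits ϖ n ≤ ω'.ker)
    (hω : conductor (higherUnits ϖ) ω' = m + 1) : higherUnits ϖ (m + 1) ≤ ω'.ker :=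
  le_ker_of_conductor_le (higherUnits_antitone ϖ) hex hω.le

/-- **The Gauss-sum identity for a character of `𝒪^×`.** For `ω' : 𝒪^× → ℂ^×` of conductor exponent
exactly `m + 1` and `Ψ` an additive character of the fraction field of conductor exactly `𝒪`,
`𝔤(χ)·𝔤(χ⁻¹) = ω'(−1)` for `χ = descendChar ω'` on `𝒪 ⧸ (ϖ^{m+1})` against `ψ_{m+1} = shiftChar`. -/
theorem gNorm_mul_gNorm_inv_descendChar {K : Type*} [Field K] [Algebra 𝒪 K] [IsFractionRing 𝒪 K]
    [Fintype (𝒪 ⧸ Ideal.span ({ϖ ^ (m + 1)} : Set 𝒪))] (hϖ : Irreducible ϖ) {ω' : 𝒪ˣ →* ℂˣ}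
    (hex : ∃ n, higherUnits ϖ n ≤ ω'.ker) (hω : conductor (higherUnits ϖ) ω' = m + 1)
    (Ψ : AddChar K ℂ) (hΨ : ∀ x : 𝒪, Ψ (algebraMap 𝒪 K x) = 1) {y : 𝒪}
    (hy : Ψ (algebraMap 𝒪 K y / algebraMap 𝒪 K ϖ) ≠ 1) :
    gNorm (descendChar hϖ ω' (higherUnits_le_ker_of_conductor_eq hex hω)) (shiftChar m hϖ Ψ hΨ)
        * gNorm (descendChar hϖ ω' (higherUnits_le_ker_of_conductor_eq hex hω))⁻¹ (shiftChar m hϖ Ψ hΨ)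
      = ((ω' (-1) : ℂˣ) : ℂ) := by
  rw [gNorm_mul_gNorm_inv_of_conductor hϖ (by rwa [pull_descendChar]) Ψ hΨ hy]
  have : (-1 : 𝒪 ⧸ Ideal.span ({ϖ ^ (m + 1)} : Set 𝒪)) = π ((-1 : 𝒪ˣ) : 𝒪) := by
    rw [Units.coe_neg_one, map_neg, map_one]
  rw [this, descendChar_mk]

end Summit.Ventures.HodgeRepro2.T5CharacterDescent
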